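/-
Copyright (c) 2026 the pub-hodgecm-mathlib formalisation cell (harness21).  Prover seat hodgecm-mathlib-F0P3a-p07 (g13), 2026-09-02.  Road «S3-ram» seeding wave (LEAD T11-41∕T11-60; owner F0P3a-p06 (g15));
(α₂) organ A₂ (d-ax-3) «AXIS DEPTH TRANSFER» for the type-(2) G-side (design memos `DESIGN-A2d-TypeTwoGSide.v1_2` (L2), v1.3 (S-0)).
-/
import Literature.NumberTheory.Automorphic.UnitaryLatticeTreeBlockGluing   -- ★ p847353 (this seat): `mem_sup_span_singleton_iff`; ⊇ ★ p847252 `mulVec_single_of_col_eq`, `mulVec_apply_eq_zero_of_row_eq`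
import HarnessLib

/-!
# The lattice graph of a hermitian space — AXIS vertices `B ⊕ 𝒪e_i`: integrality and depth of a block operator transfer from the W-part
# (Bruhat–Tits 1972 §10; Kottwitz 1986 §3)

Topic `NumberTheory/Automorphic`; namespace `Literature.NumberTheory.Automorphic.UnitaryLatticeTree`.  THEOREMS ONLY (no definition, no instance, no notation, no named fact,
no `sorry`); kernel lane `--supports stmt-HodgeConjecture-24833`; datum-free (`K` with `Valued K ℤᵐ⁰`).  Cell `pub/hodgecm-mathlib`, crux H413 = `stmt-HodgeConjecture-24833`;
road «S3-ram» (count-neutral), (α₂) P-2-ram organ A₂ (d) «type-(2) G-side counts», part **(d-ax-3) AXIS DEPTH TRANSFER** — the lattice half of law (L2) of memo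
`F0/P3a/F0P3a-p07/g13/type2G/DESIGN-A2d-TypeTwoGSide.v1_2.F0P3ap07g13.md` («on the axis the residual datum of `γ_W ⊕ u` is that of `γ_W` on `B` as long as `u − 1` is deeper»).
Seat F0P3a-p07 (g13).  HONEST LABEL: HC_CM is proved only modulo the cell's 2 remaining named inputs (hLiu418 24832, h413 24833) until rung 0 closes; nothing printed is asserted
here (elementary lattice algebra over a valuation ring).

THE MATHEMATICS.  `V = K³ = W_i ⊕ Ke_i`.  An AXIS lattice is `M = B ⊕ 𝒪e_i` with `B ⊆ W_i` — abstractly: `e_i ∈ M`, `x − x_i e_i ∈ M` and `|x_i| ≤ 1` for `x ∈ M` (§1; for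
`M = B ⊔ 𝒪e_i` these hold, `axis_of_sup_span_single`, and `M ∩ W_i = B`, `mem_sup_span_single_iff_of_apply_eq_zero`).  For an operator `T` whose `i`-th COLUMN is `T_{ii}e_i`
(`T = T_W ⊕ T_{ii}` when also the `i`-th row vanishes off the diagonal — the shape of `γ_W ⊕ u − c` and of its `ϖ`-scalings):
* **INTEGRALITY TRANSFER** (`forall_mulVec_mem_iff_of_axis`): `T·M ⊆ M ⟺ T·(M ∩ W_i) ⊆ M ∧ |T_{ii}| ≤ 1`;
* **DEPTH TRANSFER** (`forall_smul_mulVec_mem_iff_of_axis`): `c⁻¹T·M ⊆ M ⟺ c⁻¹T·(M ∩ W_i) ⊆ M ∧ |T_{ii}| ≤ |c|` — the depth of `T` at the axis vertex is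
  `min(depth of T_W at B, v(T_{ii}))`; with `T = γ − 1 = (γ_W − 1) ⊕ (u − 1)`: `d(M) = min(d_B, d_u)` (memo (L2): `d_u = 2k_u + 1 ≥ 3`, so the labels `bd∕reg∕1±` of an axis
  vertex are those of `γ_W` on `B`, and `0` iff `d_B ≥ 2`);
* the `B ⊔ 𝒪e_i` forms (`forall_mulVec_mem_sup_span_single_iff`, `forall_smul_mulVec_mem_sup_span_single_iff`): `… ⟺ (∀ b ∈ B, c⁻¹T b ∈ B) ∧ |T_{ii}| ≤ |c|` for `T`
  block at `i` (row and column).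
Companions: ★ p847298 `rank_eq_rank_submatrix_succAbove_add_of_block` (the residual RANK of a block matrix = rank of the W-block + `[T_{ii} ≠ 0]`), ★ p847293 (axis level law).

## References
* [BruhatTits1972] F. Bruhat, J. Tits, *Groupes réductifs sur un corps local I*, Publ. Math. IHÉS 41 (1972), §10 (lattice models of the building).
* [Kottwitz1986] R. E. Kottwitz, *Base change for unit elements of Hecke algebras*, Compositio Math. 60 (1986), §3 (fixed lattices, depth).
* [Jacobowitz1962] R. Jacobowitz, *Hermitian forms over local fields*, Amer. J. Math. 84 (1962), §4.
-/

set_option autoImplicit false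

noncomputable section

open scoped Valued WithZero Matrix MatrixGroups

namespace Literature.NumberTheory.Automorphic.UnitaryLatticeTree

open Literature.NumberTheory.Automorphic Literature.NumberTheory.Automorphic.HermitianLattice

variable {K : Type*} [Field K] [Valued K ℤᵐ⁰]

/-! ## §1 Axis lattices: `𝒪e_i ⊆ M`, and the `B ⊔ 𝒪e_i` model -/

/-- `a·e_i ∈ M` for `|a| ≤ 1` once `e_i ∈ M`. [cite: BruhatTits1972, §10] -/
theorem single_mem_of_single_one_mem {N : ℕ} {M : Submodule 𝒪[K] (Fin N → K)} (i : Fin N) (he : (Pi.single i (1 : K) : Fin N → K) ∈ M) {a : K}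
    (ha : Valued.v a ≤ 1) : (Pi.single i a : Fin N → K) ∈ M := by
  have e : ((⟨a, (mem_integer_iff' _).2 ha⟩ : 𝒪[K]) • (Pi.single i (1 : K) : Fin N → K)) = Pi.single i a := by
    rw [show ((⟨a, (mem_integer_iff' _).2 ha⟩ : 𝒪[K]) • (Pi.single i (1 : K) : Fin N → K)) = a • (Pi.single i (1 : K) : Fin N → K) from rfl,
      ← Pi.single_smul', smul_eq_mul, mul_one]
  rw [← e]; exact M.smul_mem _ he

/-- **THE `B ⊔ 𝒪e_i` MODEL IS AN AXIS LATTICE**: for `B ⊆ W_i`, `M = B ⊔ 𝒪e_i` has `e_i ∈ M`, `x − x_i e_i ∈ M` and `|x_i| ≤ 1` for `x ∈ M`. [cite: BruhatTits1972, §10] -/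
theorem axis_of_sup_span_single {N : ℕ} {B : Submodule 𝒪[K] (Fin N → K)} (i : Fin N) (hBW : ∀ b ∈ B, b i = 0) :
    (Pi.single i (1 : K) : Fin N → K) ∈ B ⊔ Submodule.span 𝒪[K] {(Pi.single i (1 : K) : Fin N → K)} ∧
      (∀ x ∈ B ⊔ Submodule.span 𝒪[K] {(Pi.single i (1 : K) : Fin N → K)}, x - Pi.single i (x i) ∈ B ⊔ Submodule.span 𝒪[K] {(Pi.single i (1 : K) : Fin N → K)}) ∧
      (∀ x ∈ B ⊔ Submodule.span 𝒪[K] {(Pi.single i (1 : K) : Fin N → K)}, Valued.v (x i) ≤ 1) := by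
  have hxi : ∀ x ∈ B ⊔ Submodule.span 𝒪[K] {(Pi.single i (1 : K) : Fin N → K)}, ∃ t : K, Valued.v t ≤ 1 ∧ x - t • Pi.single i (1 : K) ∈ B ∧ x i = t := by
    intro x hx
    obtain ⟨t, ht, hb⟩ := mem_sup_span_singleton_iff.1 hx
    refine ⟨t, ht, hb, ?_⟩
    have h := hBW _ hb
    rw [Pi.sub_apply, Pi.smul_apply, Pi.single_eq_same, smul_eq_mul, mul_one, sub_eq_zero] at h
    exact h
  refine ⟨Submodule.mem_sup_right (Submodule.mem_span_singleton_self _), fun x hx => ?_, fun x hx => ?_⟩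
  · obtain ⟨t, -, hb, hxt⟩ := hxi x hx
    have e : (Pi.single i t : Fin N → K) = t • Pi.single i (1 : K) := by rw [← Pi.single_smul', smul_eq_mul, mul_one]
    rw [hxt, e]
    exact Submodule.mem_sup_left hb
  · obtain ⟨t, ht, -, hxt⟩ := hxi x hx
    rw [hxt]; exact ht

/-- **`M ∩ W_i = B`** in the model: for `w ∈ W_i`, `w ∈ B ⊔ 𝒪e_i ⟺ w ∈ B`. [cite: BruhatTits1972, §10] -/
theorem mem_sup_span_single_iff_of_apply_eq_zero {N : ℕ} {B : Submodule 𝒪[K] (Fin N → K)} (i : Fin N) (hBW : ∀ b ∈ B, b i = 0) {w : Fin N → K} (hwi : w i = 0) :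
    w ∈ B ⊔ Submodule.span 𝒪[K] {(Pi.single i (1 : K) : Fin N → K)} ↔ w ∈ B := by
  refine ⟨fun hw => ?_, fun hw => Submodule.mem_sup_left hw⟩
  obtain ⟨t, -, hb⟩ := mem_sup_span_singleton_iff.1 hw
  have h := hBW _ hb
  rw [Pi.sub_apply, Pi.smul_apply, Pi.single_eq_same, smul_eq_mul, mul_one, hwi, zero_sub, neg_eq_zero] at h
  rw [h, zero_smul, sub_zero] at hb
  exact hb

/-! ## §2 Integrality transfer at an axis vertex -/

/-- **INTEGRALITY TRANSFER**: at an axis lattice `M` (`e_i ∈ M`, `x − x_ie_i ∈ M`, `|x_i| ≤ 1`), an operator `T` with `T e_i = T_{ii} e_i` is integral on `M` iff it is integral on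
`M ∩ W_i` and `|T_{ii}| ≤ 1`. [cite: Kottwitz1986, §3] [cite: BruhatTits1972, §10] -/
theorem forall_mulVec_mem_iff_of_axis {M : Submodule 𝒪[K] (Fin 3 → K)} (i : Fin 3)
    (he : (Pi.single i (1 : K) : Fin 3 → K) ∈ M) (hsplit : ∀ x ∈ M, x - Pi.single i (x i) ∈ M) (hint : ∀ x ∈ M, Valued.v (x i) ≤ 1)
    {T : Matrix (Fin 3) (Fin 3) K} (hcol : ∀ l, l ≠ i → T l i = 0) :
    (∀ x ∈ M, T *ᵥ x ∈ M) ↔ (∀ w ∈ M, w i = 0 → T *ᵥ w ∈ M) ∧ Valued.v (T i i) ≤ 1 := by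
  constructor
  · intro h
    refine ⟨fun w hw _ => h w hw, ?_⟩
    have h1 := hint _ (h _ he)
    rwa [mulVec_single_of_col_eq T i hcol, mul_one, Pi.single_eq_same] at h1
  · rintro ⟨hW, hT⟩ x hx
    have e : x = (x - Pi.single i (x i)) + Pi.single i (x i) := (sub_add_cancel _ _).symm
    rw [e, Matrix.mulVec_add, mulVec_single_of_col_eq T i hcol]
    refine M.add_mem (hW _ (hsplit x hx) (by simp)) (single_mem_of_single_one_mem i he ?_)
    rw [map_mul]; exact mul_le_one' hT (hint x hx)

/-- **DEPTH TRANSFER**: same setting, `c ≠ 0`: `c⁻¹T` is integral on `M` iff it is integral on `M ∩ W_i` and `|T_{ii}| ≤ |c|` — the depth of `T` at the axis vertex is the minimum of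
the W-depth and `v(T_{ii})`. [cite: Kottwitz1986, §3] [cite: BruhatTits1972, §10] -/
theorem forall_smul_mulVec_mem_iff_of_axis {M : Submodule 𝒪[K] (Fin 3 → K)} (i : Fin 3)
    (he : (Pi.single i (1 : K) : Fin 3 → K) ∈ M) (hsplit : ∀ x ∈ M, x - Pi.single i (x i) ∈ M) (hint : ∀ x ∈ M, Valued.v (x i) ≤ 1)
    {T : Matrix (Fin 3) (Fin 3) K} (hcol : ∀ l, l ≠ i → T l i = 0) {c : K} (hc : c ≠ 0) :
    (∀ x ∈ M, c⁻¹ • (T *ᵥ x) ∈ M) ↔ (∀ w ∈ M, w i = 0 → c⁻¹ • (T *ᵥ w) ∈ M) ∧ Valued.v (T i i) ≤ Valued.v c := by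
  have hcol' : ∀ l, l ≠ i → (c⁻¹ • T) l i = 0 := fun l hl => by rw [Matrix.smul_apply, hcol l hl, smul_zero]
  have key := forall_mulVec_mem_iff_of_axis i he hsplit hint hcol'
  simp only [Matrix.smul_mulVec, Matrix.smul_apply, smul_eq_mul] at key
  rw [key, map_mul, map_inv₀, inv_mul_le_iff₀ (zero_lt_iff.2 ((Valuation.ne_zero_iff _).2 hc)), mul_one]

/-! ## §3 The `B ⊔ 𝒪e_i` forms for a block operator -/

/-- **INTEGRALITY ON `B ⊕ 𝒪e_i`** for `T` BLOCK at `i` (row and column): `T·(B ⊔ 𝒪e_i) ⊆ B ⊔ 𝒪e_i ⟺ (∀ b ∈ B, T b ∈ B) ∧ |T_{ii}| ≤ 1` (`B ⊆ W_i`).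
[cite: Kottwitz1986, §3] [cite: BruhatTits1972, §10] -/
theorem forall_mulVec_mem_sup_span_single_iff {B : Submodule 𝒪[K] (Fin 3 → K)} (i : Fin 3) (hBW : ∀ b ∈ B, b i = 0)
    {T : Matrix (Fin 3) (Fin 3) K} (hcol : ∀ l, l ≠ i → T l i = 0) (hrow : ∀ l, l ≠ i → T i l = 0) :
    (∀ x ∈ B ⊔ Submodule.span 𝒪[K] {(Pi.single i (1 : K) : Fin 3 → K)}, T *ᵥ x ∈ B ⊔ Submodule.span 𝒪[K] {(Pi.single i (1 : K) : Fin 3 → K)}) ↔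
      (∀ b ∈ B, T *ᵥ b ∈ B) ∧ Valued.v (T i i) ≤ 1 := by
  obtain ⟨he, hsplit, hint⟩ := axis_of_sup_span_single (B := B) i hBW
  rw [forall_mulVec_mem_iff_of_axis i he hsplit hint hcol]
  refine and_congr_left fun _ => ⟨fun h b hb => ?_, fun h w hw hwi => ?_⟩
  · exact (mem_sup_span_single_iff_of_apply_eq_zero i hBW (mulVec_apply_eq_zero_of_row_eq T i hrow (hBW b hb))).1
      (h b (Submodule.mem_sup_left hb) (hBW b hb))
  · have hwB := (mem_sup_span_single_iff_of_apply_eq_zero i hBW hwi).1 hw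
    exact Submodule.mem_sup_left (h w hwB)

/-- **DEPTH ON `B ⊕ 𝒪e_i`** for `T` BLOCK at `i`, `c ≠ 0`: `c⁻¹T·(B ⊔ 𝒪e_i) ⊆ B ⊔ 𝒪e_i ⟺ (∀ b ∈ B, c⁻¹T b ∈ B) ∧ |T_{ii}| ≤ |c|` — at `c = ϖ^d`: `d(B ⊕ 𝒪e_i) ≥ d ⟺
d_B ≥ d ∧ v(T_{ii}) ≥ d`, the depth law of an axis vertex (memo (L2)). [cite: Kottwitz1986, §3] [cite: BruhatTits1972, §10] -/
theorem forall_smul_mulVec_mem_sup_span_single_iff {B : Submodule 𝒪[K] (Fin 3 → K)} (i : Fin 3) (hBW : ∀ b ∈ B, b i = 0)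
    {T : Matrix (Fin 3) (Fin 3) K} (hcol : ∀ l, l ≠ i → T l i = 0) (hrow : ∀ l, l ≠ i → T i l = 0) {c : K} (hc : c ≠ 0) :
    (∀ x ∈ B ⊔ Submodule.span 𝒪[K] {(Pi.single i (1 : K) : Fin 3 → K)}, c⁻¹ • (T *ᵥ x) ∈ B ⊔ Submodule.span 𝒪[K] {(Pi.single i (1 : K) : Fin 3 → K)}) ↔
      (∀ b ∈ B, c⁻¹ • (T *ᵥ b) ∈ B) ∧ Valued.v (T i i) ≤ Valued.v c := by
  have hcol' : ∀ l, l ≠ i → (c⁻¹ • T) l i = 0 := fun l hl => by rw [Matrix.smul_apply, hcol l hl, smul_zero]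
  have hrow' : ∀ l, l ≠ i → (c⁻¹ • T) i l = 0 := fun l hl => by rw [Matrix.smul_apply, hrow l hl, smul_zero]
  have key := forall_mulVec_mem_sup_span_single_iff (B := B) i hBW hcol' hrow'
  simp only [Matrix.smul_mulVec, Matrix.smul_apply, smul_eq_mul] at key
  rw [key, map_mul, map_inv₀, inv_mul_le_iff₀ (zero_lt_iff.2 ((Valuation.ne_zero_iff _).2 hc)), mul_one]

/-! ## §4 (ED. 2) Axis self-duality: `B ⊔ 𝒪e_i` is self-dual iff `B` is self-dual inside `W_i`

The degenerate gluing `x₀ = e_i` (`|c₀| = 1`; ★ p847353 §3 needs `|c₀| > 1`): an AXIS vertex `M = B ⊕ 𝒪e_i` (memo v1.2 (L1): `a(M) = 0`).  With §3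
(`forall_mulVec_mem_sup_span_single_iff`: `γ·(B ⊕ 𝒪e_i) ⊆ B ⊕ 𝒪e_i ⟺ γ_W B ⊆ B ∧ |u| ≤ 1` for `γ = γ_W ⊕ u`) this is the bridge «fixed self-dual AXIS vertices of `γ_W ⊕ u` ↔
`γ_W`-fixed self-dual lattices of `W`» behind `#{a = 0}(t₀) = m⁰(N)` (A-p12 (g23)'s edge count) and `#{a = 0}(t₁) = 1` (F0P3a-p03 (g17) ★ `…AnisotropicPlane`). -/

section Axis

variable {σ : K →+* K} {H : Matrix (Fin 3) (Fin 3) K} {i : Fin 3} {B : Submodule 𝒪[K] (Fin 3 → K)}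

/-- **`y ∈ (B ⊔ 𝒪e_i)^♯ ⟺ (∀ b ∈ B, |⟨b, y⟩| ≤ 1) ∧ |y_i| ≤ 1`** for a form block at `i` with `|H_{ii}| = 1` (`⟨e_i, y⟩ = σ(1)H_{ii}y_i`). [cite: Jacobowitz1962, §4] [cite: BruhatTits1972, §10] -/
theorem mem_dualLatt_sup_span_single_iff (hvσ : ∀ a, Valued.v (σ a) = Valued.v a) (hHrow : ∀ l, l ≠ i → H i l = 0) (hhi : Valued.v (H i i) = 1) (y : Fin 3 → K) :
    y ∈ dualLatt σ H (B ⊔ Submodule.span 𝒪[K] {(Pi.single i (1 : K) : Fin 3 → K)}) ↔ (∀ b ∈ B, Valued.v (pairing σ H b y) ≤ 1) ∧ Valued.v (y i) ≤ 1 := by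
  rw [mem_dualLatt_sup_span_iff hvσ, pairing_single_left_of_block σ H i hHrow, map_one, one_mul, map_mul, hhi, one_mul]

/-- **AXIS SELF-DUALITY: if `B ⊆ W_i` is SELF-DUAL INSIDE `W_i`** (`w ∈ W_i`: `w ∈ B ⟺ ∀ b ∈ B, |⟨b, w⟩| ≤ 1`) **then `(B ⊔ 𝒪e_i)^♯ = B ⊔ 𝒪e_i`** — the axis lattice
`B ⊕ 𝒪e_i` is self-dual (form block at `i`, `|H_{ii}| = 1`, `σ` valuation-preserving); the case `a = 0` of the gluing theorem ★ `dualLatt_sup_span_eq_of_glue`.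
[cite: Jacobowitz1962, §4] [cite: BruhatTits1972, §10] [cite: Kottwitz1986, §3] -/
theorem dualLatt_sup_span_single_eq_of_axis (hvσ : ∀ a, Valued.v (σ a) = Valued.v a)
    (hHrow : ∀ l, l ≠ i → H i l = 0) (hHcol : ∀ l, l ≠ i → H l i = 0) (hhi : Valued.v (H i i) = 1) (hBW : ∀ b ∈ B, b i = 0)
    (hBdual : ∀ w : Fin 3 → K, w i = 0 → (w ∈ B ↔ ∀ b ∈ B, Valued.v (pairing σ H b w) ≤ 1)) :
    dualLatt σ H (B ⊔ Submodule.span 𝒪[K] {(Pi.single i (1 : K) : Fin 3 → K)}) = B ⊔ Submodule.span 𝒪[K] {(Pi.single i (1 : K) : Fin 3 → K)} := by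
  obtain ⟨-, -, hint⟩ := axis_of_sup_span_single (B := B) i hBW
  refine le_antisymm (fun y hy => ?_) (fun y hy => ?_)
  · -- `♯ ≤`: `|y_i| ≤ 1` from `e_i ∈ M`, and `y − y_i e_i ∈ W_i ∩ B^{♯_W} = B`
    obtain ⟨hB, hyi⟩ := (mem_dualLatt_sup_span_single_iff hvσ hHrow hhi y).1 hy
    rw [mem_sup_span_singleton_iff]
    refine ⟨y i, hyi, (hBdual _ (by simp)).2 fun b hb => ?_⟩
    rw [map_sub, map_smul, smul_eq_mul, pairing_single_right_of_block σ H i hHcol, hBW b hb, map_zero, zero_mul, zero_mul, mul_zero, sub_zero]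
    exact hB b hb
  · -- `≤ ♯`: integrality of the Gram data of `B ⊕ 𝒪e_i`
    obtain ⟨t, -, hb⟩ := mem_sup_span_singleton_iff.1 hy
    have e : y = (y - t • Pi.single i (1 : K)) + t • Pi.single i (1 : K) := (sub_add_cancel _ _).symm
    rw [mem_dualLatt_sup_span_single_iff hvσ hHrow hhi]
    refine ⟨fun b hbB => ?_, hint y hy⟩
    rw [e, map_add, map_smul, smul_eq_mul, pairing_single_right_of_block σ H i hHcol, hBW b hbB, map_zero, zero_mul, zero_mul, mul_zero, add_zero]
    exact ((hBdual _ (hBW _ hb)).1 hb) b hbB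

/-- **THE AXIS BRIDGE, converse half: for a self-dual axis lattice the W-part is self-dual inside `W_i`** — if `(B ⊔ 𝒪e_i)^♯ = B ⊔ 𝒪e_i` then `w ∈ B ⟺ ∀ b ∈ B, |⟨b,w⟩| ≤ 1`
for `w ∈ W_i` (form block at `i`, `|H_{ii}| = 1`). [cite: Jacobowitz1962, §4] [cite: BruhatTits1972, §10] -/
theorem mem_iff_forall_pairing_le_one_of_dualLatt_sup_span_single_eq (hvσ : ∀ a, Valued.v (σ a) = Valued.v a)
    (hHrow : ∀ l, l ≠ i → H i l = 0) (hhi : Valued.v (H i i) = 1) (hBW : ∀ b ∈ B, b i = 0)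
    (hM : dualLatt σ H (B ⊔ Submodule.span 𝒪[K] {(Pi.single i (1 : K) : Fin 3 → K)}) = B ⊔ Submodule.span 𝒪[K] {(Pi.single i (1 : K) : Fin 3 → K)})
    {w : Fin 3 → K} (hwi : w i = 0) :
    w ∈ B ↔ ∀ b ∈ B, Valued.v (pairing σ H b w) ≤ 1 := by
  rw [← mem_sup_span_single_iff_of_apply_eq_zero i hBW hwi, ← hM, mem_dualLatt_sup_span_single_iff hvσ hHrow hhi, hwi, map_zero]
  exact ⟨fun h => h.1, fun h => ⟨h, zero_le⟩⟩

end Axis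

end Literature.NumberTheory.Automorphic.UnitaryLatticeTree

end
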